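import Summits.HodgeConjecture.HodgeConjecture.Theorems.F0P3KitOfRecord                 -- ★ p822184 (p04 (g7), K0): `kitOfRecord` (+ ★ V6-A kit, ★ «UL» `unitaryLoc₀`∕`IsCohUnitaryClass`, ★ `TestS₀`∕`chS₀`)
import Summits.HodgeConjecture.HodgeConjecture.Theorems.F0P3ClassificationLawsV6        -- ★ p822130 (V6-B): the law text `ClassificationKit.LinIndepS` (= v7 text)
import Literature.NumberTheory.Rogawski1990.SemilocalCharactersLinIndep                   -- ★ (F0-typ1 (g6), K8 §7): the letter (L2-SA) `SemilocalCharactersLinIndep`, `.eq_zero`, `ArchTestKc`; ★ `archTr₀`, ★ `GKIrrep.IsInfUnitaryAlongP`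
import HarnessLib

/-!
# GLUE for row #8 (L2) `LinIndepS` AT `𝔠₀`: the letter (L2-SA) «SemilocalCharactersLinIndep» ⇒ `(kitOfRecord … (archTr₀ … νinf) ν μv …).LinIndepS`

Cell `hodgecm-mathlib`, F0∕P3 «U3-mult», crux H413 (`stmt-HodgeConjecture-24833`), rung 4; F0P3-p01 (g8) on F0P3-plan (g5)'s HAND 13:18:12Z (K8-LETTERS §7, last paragraph).
PROOF LANE: theorems only; no `def`, no instance, no notation, no `sorry`.  Discharges K7 ED. 3's hypothesis `h8 : 𝔠₀.LinIndepS` from the ★ Literature letter.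

THE LAW [Rogawski1990 Prop. 13.8.1 p. 206; JacquetLanglands1970 Lemma 16.1.1]: `ClassificationKit.LinIndepS 𝔠 := ∀ S (a : LocS L H S → ℂ), (∀ x, a x ≠ 0 → 𝔠.UnitaryLoc S x) →
(∀ fS : 𝔠.TestS S, Summable (x ↦ a x · 𝔠.chS S x fS)) → (∀ fS, ∑' x, a x · 𝔠.chS S x fS = 0) → ∀ x, a x = 0` (★ V6-B, unchanged in v7).
AT THE KIT OF RECORD `𝔠₀ := kitOfRecord L H ι T hT μ 𝔰 gh ξd μω c jInf dsInf (archTr₀ L ι H T hT νinf) ν μv ramCls₀` (★ K0 with D8-1's ★ `archTr₀` plugged):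
`UnitaryLoc := unitaryLoc₀ L H` (★ «UL»: `IsCohUnitaryClass x.1 ∧ ∀ v, (x.2 v).IsUnitarizable`), `TestS := TestS₀ L H ι T hT`, `chS := chS₀ (archTr₀ …) μv`
(`= archTr₀ … x.1 fS.arch · ∏_{v∈S} (x.2 v).smoothTrace (μv v) (fS.loc v)` by `rfl`).
THE LETTER (★ `SemilocalCharactersLinIndep L ι H T hT νinf μv`, H1, typ1 (g6)) is exactly this statement over coordinate TUPLES with (a) the support clause
`∃ r : GKIrrep U21, GKIrrClass.mk r = x.1 ∧ IsAdmissibleGK r.ρK ∧ r.IsInfUnitaryAlongP` — which IS `IsCohUnitaryClass x.1` up to the fields of ★ `IsCohUnitaryIrrep`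
(`adm`, `unit`): typ3's ★ `IsInfUnitaryAlongP ρ𝔤` (p823077) and P3b's ★ `IsUnitaryAlongP ρ𝔤` have IDENTICAL bodies, so the two unitarity currencies agree by `δ`
(`isCohUnitaryClass_iff_support`, REF1 (g5) rider 1); (b) test data `(φ, f)` with `ArchTestKc φ` = the three archimedean clauses of ★ `TestS₀` and `f v` locally constant
compactly supported = its two finite clauses, i.e. `TestS₀ S` field for field; (c) the frame guard `hdef` and the two HAAR antecedents (`νinf`, `μv`), passed through.

References: [Rogawski1990] Prop. 13.8.1 p. 206; §14.5 p. 237; [JacquetLanglands1970] Lemma 16.1.1; [LabesseLanglands1979] p. 768.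
HC_CM is proved only modulo the printed citations until rung 0 closes.
-/

set_option autoImplicit false
set_option linter.dupNamespace false

noncomputable section

open NumberField IsDedekindDomain MeasureTheory
open Literature.NumberTheory.Rogawski1990 Literature.NumberTheory.GaloisRepresentations
open Literature.NumberTheory.Automorphic Literature.NumberTheory.Automorphic.UnitaryGroup
open Literature.RepresentationTheory.KonnoKonno2007
open scoped Matrix ComplexOrder

namespace Summit.HodgeConjecture.HodgeConjecture.Cruxes.H413.F0P3LettersLinIndepS

open Summit.HodgeConjecture.HodgeConjecture.Cruxes.H413.F0P3InnerFormClassificationV6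
open Summit.HodgeConjecture.HodgeConjecture.Cruxes.H413.F0P3KitOfRecord (kitOfRecord XiSide GHSide)
open Summit.HodgeConjecture.HodgeConjecture.Cruxes.H413.F0P3UnitaryLocOfRecord (IsCohUnitaryClass unitaryLoc₀)
open Summit.HodgeConjecture.HodgeConjecture.Cruxes.H413.F0P3SemilocalTestFunctionsOfRecord (TestS₀ chS₀)

/-! ## §1 The two unitarity currencies agree (REF1 (g5) rider 1) -/

/-- **`IsCohUnitaryClass x ↔` the letter's support clause**: `∃ r, GKIrrClass.mk r = x ∧ IsCohUnitaryIrrep r.ρK r.ρ𝔤` iff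
`∃ r, GKIrrClass.mk r = x ∧ IsAdmissibleGK r.ρK ∧ r.IsInfUnitaryAlongP` — the (𝔤,K)-module and irreducibility clauses of ★ `IsCohUnitaryIrrep` are the fields of `r : GKIrrep`,
and ★ `IsUnitaryAlongP ρ𝔤` (P3b) IS ★ `IsInfUnitaryAlongP ρ𝔤` (typ3, p823077) by `δ` (identical bodies). [cite: BorelWallach2000, 0 §2.5] [cite: Rogawski1990, Prop. 13.8.1 p. 206] -/
theorem isCohUnitaryClass_iff_support (x : GKIrrClass (uFormGroup (Fin 2) (Fin 1))) :
    IsCohUnitaryClass x ↔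
      ∃ r : GKIrrep (uFormGroup (Fin 2) (Fin 1)), GKIrrClass.mk r = x ∧ IsAdmissibleGK r.ρK ∧ r.IsInfUnitaryAlongP := by
  constructor
  · rintro ⟨r, hr, h⟩
    exact ⟨r, hr, h.adm, h.unit⟩
  · rintro ⟨r, hr, hadm, hunit⟩
    exact ⟨r, hr, ⟨r.isGKModule, r.isIrreducible, hadm, hunit⟩⟩

/-! ## §2 The glue -/

variable (L : Type) [Field L] [NumberField L] [IsCMField L] (H : Matrix (Fin 3) (Fin 3) L) (ι : L →+* ℂ) (T : GL (Fin 3) ℂ)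
  (hT : (T : Matrix (Fin 3) (Fin 3) ℂ)ᴴ * H.map ι * (T : Matrix (Fin 3) (Fin 3) ℂ) = Literature.Geometry.ComplexHyperbolic.BallModel.J)
  (μ : Measure (Gp L H).automorphicQuotient) [(Gp L H).IsAutomorphicMeasure μ]
  [MeasurableSpace (Gp L H).Adelic] [BorelSpace (Gp L H).Adelic]
  (𝔰 : Sockets L H μ) (gh : GHSide L H ι T hT 𝔰.PacketG 𝔰.PacketH) (ξd : XiSide L H 𝔰.PacketG 𝔰.PacketH)
  (μω : HeckeCharacter L) (c : ℚ) (jInf dsInf : ℤ → ℤ → ℤ → Cinf)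
  (νinf : @Measure (UnitaryGroup.arch (↥(maximalRealSubfield L)) L (IsCMField.complexConj L) 3 H) (borel _))
  (ν : Measure (Gp L H).Adelic) [IsFiniteMeasureOnCompacts ν]
  (μv : ∀ v : Places L, @Measure ((cmDatum L 3 H).Local v) (borel _))
  (ramCls₀ : DiscreteAutomorphicRep (Gp L H) μ → Set (Places L))

/-- **Row #8 — law `LinIndepS` AT `𝔠₀` FROM THE LETTER (L2-SA)** (K7 ED. 3's `h8`): for the kit of record with D8-1's archimedean character ★ `archTr₀ L ι H T hT νinf`
plugged and Haar data `νinf`, `μv` (the letter's two Haar antecedents; the frame guard `hdef` is the head's), linear independence of the characters of irreducible unitary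
representations of `G′_ι∕Kc × ∏_{v∈S} G′_v` on the kit's test data. [cite: Rogawski1990, Prop. 13.8.1 p. 206] [cite: JacquetLanglands1970, Lemma 16.1.1] -/
theorem linIndepS_kitOfRecord (h : SemilocalCharactersLinIndep L ι H T hT νinf μv)
    (hdef : ∀ τ' : L →+* ℂ, InfinitePlace.mk τ' ≠ InfinitePlace.mk ι → (H.map τ').PosDef)
    (hν : @Measure.IsHaarMeasure _ _ _ (borel _) νinf)
    (hμ : ∀ v : HeightOneSpectrum (𝓞 ↥(maximalRealSubfield L)), @Measure.IsHaarMeasure _ _ _ (borel _) (μv v)) :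
    (kitOfRecord L H ι T hT μ 𝔰 gh ξd μω c jInf dsInf (archTr₀ L ι H T hT νinf) ν μv ramCls₀).LinIndepS := by
  intro S a ha hsum hzero x
  refine h.eq_zero hdef hν hμ S a (fun y hy => ?_) (fun φ f hφ hf => ?_) (fun φ f hφ hf => ?_) x
  · -- support: `𝔠₀.UnitaryLoc S y = unitaryLoc₀ L H S y`
    obtain ⟨hcu, hfin⟩ := ha y hy
    exact ⟨(isCohUnitaryClass_iff_support y.1).1 hcu, hfin⟩
  · -- summability at the test datum `⟨φ, f, …⟩ : TestS₀ S` (`chS₀` unfolds by `rfl`)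
    exact hsum ⟨φ, f, hφ.1, hφ.2.1, hφ.2.2, fun v => (hf v).1, fun v => (hf v).2⟩
  · exact hzero ⟨φ, f, hφ.1, hφ.2.1, hφ.2.2, fun v => (hf v).1, fun v => (hf v).2⟩

/-- The same with the Haar antecedents as INSTANCE arguments (the shape F0P3-plan (g5) 13:18:12Z wrote: `[νinf.IsHaarMeasure] [∀ v, (μv v).IsHaarMeasure]`).
[cite: Rogawski1990, Prop. 13.8.1 p. 206] -/
theorem linIndepS_kitOfRecord' (h : SemilocalCharactersLinIndep L ι H T hT νinf μv)
    (hdef : ∀ τ' : L →+* ℂ, InfinitePlace.mk τ' ≠ InfinitePlace.mk ι → (H.map τ').PosDef)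
    [hν : @Measure.IsHaarMeasure _ _ _ (borel _) νinf]
    [hμ : ∀ v : HeightOneSpectrum (𝓞 ↥(maximalRealSubfield L)), @Measure.IsHaarMeasure _ _ _ (borel _) (μv v)] :
    (kitOfRecord L H ι T hT μ 𝔰 gh ξd μω c jInf dsInf (archTr₀ L ι H T hT νinf) ν μv ramCls₀).LinIndepS :=
  linIndepS_kitOfRecord L H ι T hT μ 𝔰 gh ξd μω c jInf dsInf νinf ν μv ramCls₀ h hdef hν hμ

end Summit.HodgeConjecture.HodgeConjecture.Cruxes.H413.F0P3LettersLinIndepS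

end
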